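import Literature.AlgebraicGeometry.Frobenioids.FrobeniusTypePerfect
import HarnessLib

/-!
# Frobenioids I, Proposition 4.1 (Primary Steps), parts (i), (ii) — proofs over the Frobenioid axioms

Mochizuki, *The geometry of Frobenioids I: the general theory*, Kyushu J. Math. **62** (2008)
293–400, §4, Proposition 4.1 (i) and its proof, kurims text pp. 75–76
[cite: MochizukiFrdI2008, Prop. 4.1 (i) p.75]. Standing data (p. 75): a Frobenioid `C → F_Φ`
(`hF`) of perfect and isotropic type, `A ∈ Ob(C)`, and for `n ∈ N_{≥1}` a `Div`-identity
endomorphism `α_n` of `A` of Frobenius type with `deg_Fr(α_n) = n`.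

> "(i) `φ` is primary if and only if, for every factorization `φ = φ_A ∘ φ_B`, where
> `φ_B : B → B'`, `φ_A : B' → A` are steps, there exists a commutative diagram … `α_n ∘ φ_A = ζ ∘ β'`
> where `n ∈ N_{≥1}`; `β'` is a morphism of Frobenius type; and `ζ = φ ∘ ζ'`; and `ζ' : B'' → B`
> is a pre-step."

PROVED here along the printed proof (p. 76): "By applying the second equivalence of categories of
Definition 1.3, (iii), (d), to the various pre-steps over `A` … the condition of assertion (i) may
be translated into the language of monoids as follows: for every equation `x_φ = x_A + x_B` in
`Φ(A)`, where `x_A, x_B ≠ 0`, we have `x_φ ≼ x_A`. Now the equivalence of this condition with the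
condition that `x_φ` is primary follows immediately from the definition of the term 'primary',
together with the fact that `Φ(A)` is perfect [cf. Proposition 1.10, (iii)]."

Part (ii) (p. 75: "Suppose that `φ` is primary. Then the composite `ψ ∘ φ`, hence also `ψ`, is
primary if and only if, for every factorization `ψ ∘ φ = ψ' ∘ φ'`, where `φ'`, `ψ'` are steps,
there exist factorizations `φ = ζ ∘ φ''`, `φ' = ζ' ∘ φ''`, where `φ''` is a step, and `ζ, ζ'` are
pre-steps") is translated here exactly as in the printed proof (p. 76, "we apply Definition 1.3,
(iii), (d), to the various pre-steps … to obtain the following translation of the condition of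
assertion (ii) into the language of monoids: for every equation `x_φ + x_ψ = x_φ' + x_ψ'` where
`x_φ', x_ψ' ≠ 0`, there exists a `0 ≠ x_φ''` such that `x_φ'' ≤ x_φ`, `x_φ'' ≤ x_φ'`"):
`primaryComposite_condition_iff`; the remaining equivalence of that monoid condition with "`x_φ +
x_ψ` primary" is perf-factorial monoid theory (Def. 2.4 (i)(b)(c)(d), seat abc-iut-L1-t2).

This is the proof CORE of the named statement `PreFrobenioidData.Prop41i` (statement file
`DivisorMonoidCategoryTheoreticityDefs.lean`, seat abc-iut-L1-t3, typed over the operations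
interface `PreFrobenioidData`); the statement as typed follows from `isPrimaryPreStep_iff_of_isStep`
below through the adapter `PreFrobenioidData.ofFunctor` (companion file, filed when those modules
are built). The printed hypotheses "`Φ` perf-factorial" and "`A` Div-Frobenius-trivial" are not used
by the printed proof of (i) (only by (ii)–(v)) and are therefore not assumed. Composition is
diagrammatic (`φ_B ≫ φ_A` is the text's `φ_A ∘ φ_B`); monoids are multiplicative (`Div = 0` is
`= 1`, `x ≤ y` is `x ∣ y`, `x ≼ y` is `Precsim`).
-/

namespace Literature.AlgebraicGeometry.Frobenioids

open CategoryTheory Opposite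

universe w v v' u u'

namespace PreFrobenioid

variable {D : Type u} [Category.{v} D] {Φ : Dᵒᵖ ⥤ CommMonCat.{w}}
  {C : Type u'} [Category.{v'} C] {F : C ⥤ ElemFrobenioid Φ}

/-! ### Preliminaries -/

/-- In a Frobenioid of isotropic type a step has non-zero zero divisor (an isometric pre-step out of
an isotropic object is an isomorphism, Def. 1.2 (iv)). [cite: MochizukiFrdI2008, Def. 1.2(iv) p.23] -/
theorem div_ne_one_of_isStep (histr : IsOfIsotropicType F) {X Y : C} {ψ : X ⟶ Y}
    (hψ : IsStep F ψ) : Div F ψ ≠ 1 :=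
  fun h => hψ.2 (histr X ψ h hψ.1)

/-- The zero divisor of `φ_A ∘ α` for an isometry `α` of Frobenius degree `n`: `n · Div(φ_A)`
(Remark 1.1.1). [cite: MochizukiFrdI2008, Rem. 1.1.1 p.21] -/
theorem div_comp_isIsometry {X Y Z : C} (φ : X ⟶ Y) {α : Y ⟶ Z} (hα : IsIsometry F α) :
    Div F (φ ≫ α) = Div F φ ^ (degFr F α : ℕ) := by
  rw [div_comp, show Div F α = 1 from hα, map_one, one_mul]

/-- `Div(ψ ∘ g) = g^* Div(ψ) + Div(g)` for `ψ` linear (Remark 1.1.1).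
[cite: MochizukiFrdI2008, Rem. 1.1.1 p.21] -/
theorem div_comp_of_isLinear {Z Y A : C} (g : Z ⟶ Y) {ψ : Y ⟶ A} (hψ : IsLinear F ψ) :
    Div F (g ≫ ψ) = pull Φ (Base F g) (Div F ψ) * Div F g := by
  rw [div_comp, show degFr F ψ = 1 from hψ, PNat.one_coe, pow_one]

/-! ### Proposition 4.1 (i) -/

/-- **Proposition 4.1 (i)** (FrdI p. 75), for a Frobenioid of perfect and isotropic type and a
family `α_n` (`n ∈ N_{≥1}`) of `Div`-identity endomorphisms of `A` of Frobenius type with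
`deg_Fr(α_n) = n`: a step `φ : B → A` is primary iff for every factorisation `φ = φ_A ∘ φ_B` into
steps `φ_B : B → B'`, `φ_A : B' → A` there are `n`, a morphism of Frobenius type `β' : B' → B''` and
a pre-step `ζ' : B'' → B` with `α_n ∘ φ_A = φ ∘ ζ' ∘ β'`. Proof: translation into the monoid
`Φ(A)` by Def. 1.3 (iii)(d) (slice equivalence: pre-steps over `A` ↔ `(ψ^*)⁻¹ Div(ψ)`, fullness
and essential surjectivity), Def. 1.3 (iv)(a) to split `α_n ∘ φ_A` as (pre-step) ∘ (Frobenius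
type), and perfectness of `Φ(B)` (Prop. 1.10 (iii)) to pass between `b ≼ Div φ` and honest
factorisations `Div φ = b₁ + c₁`. [cite: MochizukiFrdI2008, Prop. 4.1 (i) p.75] -/
theorem isPrimaryPreStep_iff_of_isStep (hF : IsFrobenioid F) (hperf : IsOfPerfectType F)
    (histr : IsOfIsotropicType F) {A : C} (α : ℕ+ → (A ⟶ A))
    (hα : ∀ n, IsDivIdentity F (α n) ∧ IsFrobeniusType F (α n) ∧ degFr F (α n) = n)
    {B : C} {φ : B ⟶ A} (hφ : IsStep F φ) :
    IsPrimaryPreStep F φ ↔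
      ∀ ⦃B' : C⦄ (φB : B ⟶ B') (φA : B' ⟶ A), IsStep F φB → IsStep F φA → φB ≫ φA = φ →
        ∃ (n : ℕ+) (B'' : C) (β' : B' ⟶ B'') (ζ' : B'' ⟶ B),
          IsFrobeniusType F β' ∧ IsPreStep F ζ' ∧ φA ≫ α n = β' ≫ ζ' ≫ φ := by
  have hP := hF.isPreFrobenioid
  have hD := hP.isTotallyEpimorphic_base
  have hco : ∀ {X Y : C} (f : X ⟶ Y), IsCoAngular F f :=
    fun f => isCoAngular_of_isIsotropic_codomains F f fun Z _ => histr Z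
  have hcancel : ∀ X : D, IsCancelMul (Φ.obj (op X)) :=
    fun X => isIntegral_iff_isCancelMul.mp (hP.isDivisorial X).isPreDivisorial.isIntegral
  haveI : IsIso (Base F φ) := hφ.1.2
  have hφco : IsCoAngularPreStep F φ := ⟨hco φ, hφ.1⟩
  constructor
  · -- primary ⇒ the diagram condition
    rintro ⟨-, -, hprim⟩ B' φB φA hφB hφA hfac
    haveI : IsIso (Base F φB) := hφB.1.2
    haveI : IsIso (Base F φA) := hφA.1.2
    -- `Div φ = φ_B^* Div(φ_A) + Div(φ_B)`, both summands non-zero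
    have hdiv : Div F φ = pull Φ (Base F φB) (Div F φA) * Div F φB := by
      rw [← hfac, div_comp, show degFr F φA = 1 from hφA.1.1, PNat.one_coe, pow_one]
    have ha1 : pull Φ (Base F φB) (Div F φA) ≠ 1 := fun h => div_ne_one_of_isStep histr hφA (by
      have h' := congrArg (pull Φ (inv (Base F φB))) h
      rwa [← pull_comp, IsIso.inv_hom_id, pull_id, map_one] at h')
    -- primary: `Div φ ≼ φ_B^* Div(φ_A)`
    obtain ⟨n, hn, hdvd⟩ := hprim _ ha1 (Precsim.of_dvd (Dvd.intro _ hdiv.symm))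
    let nn : ℕ+ := ⟨n, hn⟩
    obtain ⟨hαdiv, hαFT, hαdeg⟩ := hα nn
    -- split `φ_A ≫ α_n` as (Frobenius type) ≫ (pre-step) [Def. 1.3 (iv)(a); the pull-back part is
    -- a base-isomorphism, hence an isomorphism]
    obtain ⟨X, Y, γ, β, α'', hfac2, hγ, hβ, hα''⟩ := hF.iv_a_exists (φA ≫ α nn)
    have hbi : IsBaseIso F (γ ≫ β ≫ α'') := by
      rw [hfac2]; exact IsBaseIso.comp F hφA.1.2 hαFT.2
    haveI : IsIso α'' := (isPullbackMorphism_and_isBaseIso_iff_isIso F α'').mp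
      ⟨hα'', (isBaseIso_factors F hD (isBaseIso_factors F hD hbi).1).1⟩
    have hβ₁ : IsPreStep F (β ≫ α'') := IsPreStep.comp F hβ (isPreStep_of_isIso F α'')
    haveI : IsIso (Base F (β ≫ α'')) := hβ₁.2
    have hβ₁co : IsCoAngularPreStep F (β ≫ α'') := ⟨hco _, hβ₁⟩
    have hE : φA ≫ α nn = γ ≫ β ≫ α'' := hfac2.symm
    -- divisors in `Φ(B'_D)`: `γ^* Div(β ≫ α'') = n · Div(φ_A)`
    have hd1 : pull Φ (Base F γ) (Div F (β ≫ α'')) = Div F φA ^ n := by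
      have e1 : Div F (φA ≫ α nn) = Div F φA ^ n := by
        rw [div_comp_isIsometry φA hαFT.1.2, hαdeg, PNat.mk_coe]
      have e2 : Div F (γ ≫ β ≫ α'') = pull Φ (Base F γ) (Div F (β ≫ α'')) := by
        rw [div_comp, show Div F γ = 1 from hγ.1.2, one_pow, mul_one]
      rw [← e2, ← hE, e1]
    -- bases: `Base(φ)⁻¹ ∘ … ` vs `Base(β ≫ α'')⁻¹` differ by the `Div`-identity `Base(α_n)`
    have hb3 : inv (Base F φ) ≫ Base F φB = inv (Base F φA) := by
      have hb1 : Base F φB ≫ Base F φA = Base F φ := by rw [← base_comp, hfac]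
      apply (cancel_epi (Base F φ)).mp
      rw [IsIso.hom_inv_id_assoc, ← hb1, Category.assoc, IsIso.hom_inv_id, Category.comp_id]
    have hb4 : inv (Base F φA) ≫ Base F γ = Base F (α nn) ≫ inv (Base F (β ≫ α'')) := by
      have hb2 : Base F φA ≫ Base F (α nn) = Base F γ ≫ Base F (β ≫ α'') := by
        rw [← base_comp, hE, base_comp]
      apply (cancel_epi (Base F φA)).mp
      rw [IsIso.hom_inv_id_assoc, ← Category.assoc, hb2, Category.assoc, IsIso.hom_inv_id,
        Category.comp_id]
    -- `(φ^*)⁻¹ Div φ ≤ ((β ≫ α'')^*)⁻¹ Div(β ≫ α'')` in `Φ(A)`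
    have hdvd2 : invDiv F φ hφco.2.2 ∣ invDiv F (β ≫ α'') hβ₁co.2.2 := by
      have h1 : invDiv F φ hφco.2.2 ∣
          pull Φ (inv (Base F φ)) (pull Φ (Base F φB) (Div F φA) ^ n) := by
        unfold invDiv
        exact map_dvd _ hdvd
      have h2 : pull Φ (inv (Base F φ)) (pull Φ (Base F φB) (Div F φA) ^ n) =
          invDiv F (β ≫ α'') hβ₁co.2.2 := by
        rw [← map_pow, ← hd1, ← pull_comp, ← pull_comp, hb3, hb4, pull_comp,
          show pull Φ (Base F (α nn)) = MonoidHom.id _ from hαdiv, MonoidHom.id_apply]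
        rfl
      rw [h2] at h1
      exact h1
    -- Def. 1.3 (iii)(d), slice, fullness: `β ≫ α''` factors through `φ`
    obtain ⟨ζ', hζ', hζ'fac⟩ := hF.iii_d_over_full (β ≫ α'') φ hβ₁co hφco hdvd2
    refine ⟨nn, X, γ, ζ', hγ, hζ'.2, ?_⟩
    rw [hζ'fac]
    exact hE
  · -- the diagram condition ⇒ primary
    intro hcond
    refine ⟨hφ.1, div_ne_one_of_isStep histr hφ, fun b hb1 hble => ?_⟩
    obtain ⟨m, hm, c, hc⟩ := hble
    -- `Φ(B_D)` is perfect (Prop. 1.10 (iii)): take `m`-th roots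
    have hperfB := isPerfect_divisorMonoid hF hperf B
    haveI := hcancel (baseObj F B)
    obtain ⟨b₁, hb₁⟩ := (hperfB.bijective_pow m hm).2 b
    obtain ⟨c₁, hc₁⟩ := (hperfB.bijective_pow m hm).2 c
    dsimp only at hb₁ hc₁
    have hφeq : Div F φ = b₁ * c₁ := by
      apply (hperfB.bijective_pow m hm).1
      dsimp only
      rw [mul_pow, hb₁, hc₁, hc]
    have hb₁1 : b₁ ≠ 1 := by
      rintro rfl
      rw [one_pow] at hb₁
      exact hb1 hb₁.symm
    have hb₁b : b₁ ≼ b := Precsim.of_dvd (hb₁ ▸ dvd_pow_self b₁ hm.ne')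
    by_cases hc₁1 : c₁ = 1
    · -- `Div φ = b₁ ≤ b`
      refine Precsim.trans (Precsim.of_dvd ?_) hb₁b
      rw [hφeq, hc₁1, mul_one]
    · -- an honest decomposition `Div φ = b₁ + c₁`: realise it by steps `φ = φ_A ∘ φ_B`
      -- [Def. 1.3 (iii)(d), slice: essential surjectivity for `φ_A`, fullness for `φ_B`]
      obtain ⟨B', φA, hφAco, hφAx⟩ := hF.iii_d_over_surj A (pull Φ (inv (Base F φ)) b₁)
      have hdv : invDiv F φA hφAco.2.2 ∣ invDiv F φ hφco.2.2 := by
        rw [hφAx]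
        unfold invDiv
        exact map_dvd _ (Dvd.intro c₁ hφeq.symm)
      obtain ⟨φB, hφBco, hfacB⟩ := hF.iii_d_over_full φ φA hφco hφAco hdv
      haveI : IsIso (Base F φA) := hφAco.2.2
      haveI : IsIso (Base F φB) := hφBco.2.2
      -- `φ_B^* Div(φ_A) = b₁`, `Div(φ_B) = c₁`
      have hpullA : pull Φ (Base F φB) (Div F φA) = b₁ := by
        rw [← pull_invDiv φA hφAco.2.2, hφAx, ← pull_comp, ← pull_comp, ← base_comp, hfacB,
          IsIso.hom_inv_id, pull_id]
      have hdivB : Div F φB = c₁ := by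
        have e : Div F φ = pull Φ (Base F φB) (Div F φA) * Div F φB := by
          rw [← hfacB, div_comp, show degFr F φA = 1 from hφAco.2.1, PNat.one_coe, pow_one]
        rw [hpullA, hφeq] at e
        exact (mul_left_cancel e).symm
      have hφAstep : IsStep F φA := ⟨hφAco.2, fun hiso => by
        have h1 : Div F φA = 1 := isIsometry_of_isIso F hP φA
        have h2 : pull Φ (Base F φB) (Div F φA) = 1 := by rw [h1, map_one]
        exact hb₁1 (hpullA ▸ h2)⟩
      have hφBstep : IsStep F φB := ⟨hφBco.2, fun hiso => by
        have h1 : Div F φB = 1 := isIsometry_of_isIso F hP φB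
        exact hc₁1 (hdivB ▸ h1)⟩
      -- the diagram for this factorisation
      obtain ⟨n, B'', β', ζ', hβ', hζ', hEq⟩ := hcond φB φA hφBstep hφAstep hfacB
      obtain ⟨hαdiv, hαFT, hαdeg⟩ := hα n
      -- divisors in `Φ(B'_D)`: `(ζ' ≫ β'… )`: `(β' ζ')^* Div φ ≤ n · Div(φ_A)`
      have e1 : Div F (φA ≫ α n) = Div F φA ^ (n : ℕ) := by
        rw [div_comp_isIsometry φA hαFT.1.2, hαdeg]
      have e2 : Div F (β' ≫ ζ' ≫ φ) =
          pull Φ (Base F β' ≫ Base F ζ') (Div F φ) * pull Φ (Base F β') (Div F ζ') := by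
        rw [div_comp, show Div F β' = 1 from hβ'.1.2, one_pow, mul_one, div_comp,
          show degFr F φ = 1 from hφ.1.1, PNat.one_coe, pow_one, map_mul, pull_comp]
      have e3 : pull Φ (Base F β' ≫ Base F ζ') (Div F φ) ∣ Div F φA ^ (n : ℕ) := by
        rw [← e1, hEq, e2]
        exact Dvd.intro _ rfl
      -- transport to `Φ(B_D)` along `φ_B`; the composite base arrow is `Base φ ∘ Base α_n ∘ Base φ⁻¹`,
      -- which acts trivially on `Div φ` since `α_n` is a `Div`-identity
      have hb : Base F φB ≫ Base F β' ≫ Base F ζ' = Base F φ ≫ Base F (α n) ≫ inv (Base F φ) := by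
        have h1 : Base F φA ≫ Base F (α n) = Base F β' ≫ Base F ζ' ≫ Base F φ := by
          rw [← base_comp, hEq, base_comp, base_comp]
        have h2 : Base F φ = Base F φB ≫ Base F φA := by rw [← hfacB, base_comp]
        apply (cancel_mono (Base F φ)).mp
        simp only [Category.assoc, IsIso.inv_hom_id, Category.comp_id]
        rw [← h1, h2, Category.assoc]
      have e4 : pull Φ (Base F φB) (pull Φ (Base F β' ≫ Base F ζ') (Div F φ)) = Div F φ := by
        rw [← pull_comp, hb, pull_comp, pull_comp,
          show pull Φ (Base F (α n)) = MonoidHom.id _ from hαdiv, MonoidHom.id_apply, ← pull_comp,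
          IsIso.hom_inv_id, pull_id]
      have e5 : Div F φ ∣ b₁ ^ (n : ℕ) := by
        have h := map_dvd (pull Φ (Base F φB)) e3
        rw [e4, map_pow, hpullA] at h
        exact h
      exact Precsim.trans ⟨n, n.pos, e5⟩ hb₁b

/-! ### Proposition 4.1 (ii): the translation into the language of monoids -/

/-- **Proposition 4.1 (ii)**, the translation (FrdI p. 76): for steps `φ : B → A`, `ψ : A → C` of a
Frobenioid of isotropic type, the categorical condition of (ii) — every factorisation
`ψ ∘ φ = ψ' ∘ φ'` into steps admits a step `φ'' : B → A''` and pre-steps `ζ, ζ'` with `φ = ζ ∘ φ''`,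
`φ' = ζ' ∘ φ''` — holds iff "for every equation `x_φ + x_ψ = x_φ' + x_ψ'`, where `x_φ', x_ψ' ≠ 0`,
there exists a `0 ≠ x_φ''` such that `x_φ'' ≤ x_φ`, `x_φ'' ≤ x_φ'`" in `Φ(B)` [coslice equivalence of
Def. 1.3 (iii)(d) under `B`; `x_φ = Div φ`, `x_ψ = φ^* Div ψ`].
[cite: MochizukiFrdI2008, Prop. 4.1 (ii) p.75] -/
theorem primaryComposite_condition_iff (hF : IsFrobenioid F) (histr : IsOfIsotropicType F)
    {B A C' : C} {φ : B ⟶ A} {ψ : A ⟶ C'} (hφ : IsStep F φ) (hψ : IsStep F ψ) :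
    (∀ ⦃A' : C⦄ (φ' : B ⟶ A') (ψ' : A' ⟶ C'), IsStep F φ' → IsStep F ψ' → φ' ≫ ψ' = φ ≫ ψ →
        ∃ (A'' : C) (φ'' : B ⟶ A'') (ζ : A'' ⟶ A) (ζ' : A'' ⟶ A'),
          IsStep F φ'' ∧ IsPreStep F ζ ∧ IsPreStep F ζ' ∧ φ'' ≫ ζ = φ ∧ φ'' ≫ ζ' = φ') ↔
      ∀ X' Y' : Φ.obj (op (baseObj F B)), X' ≠ 1 → Y' ≠ 1 →
        Div F φ * pull Φ (Base F φ) (Div F ψ) = X' * Y' →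
          ∃ X'' : Φ.obj (op (baseObj F B)), X'' ≠ 1 ∧ X'' ∣ Div F φ ∧ X'' ∣ X' := by
  have hP := hF.isPreFrobenioid
  have hco : ∀ {X Y : C} (f : X ⟶ Y), IsCoAngular F f :=
    fun f => isCoAngular_of_isIsotropic_codomains F f fun Z _ => histr Z
  haveI : IsCancelMul (Φ.obj (op (baseObj F B))) :=
    isIntegral_iff_isCancelMul.mp (hP.isDivisorial (baseObj F B)).isPreDivisorial.isIntegral
  have hφψ : Div F (φ ≫ ψ) = Div F φ * pull Φ (Base F φ) (Div F ψ) := by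
    rw [div_comp_of_isLinear φ hψ.1.1, mul_comm]
  constructor
  · intro hC X' Y' hX' hY' hXY
    -- realise `X'` by a step `φ'` under `B`, and `ψ'` by fullness of the coslice equivalence
    obtain ⟨A', φ', hφ'co, hφ'x⟩ := hF.iii_d_under_surj B X'
    haveI : IsIso (Base F φ') := hφ'co.2.2
    have e : Div F (φ ≫ ψ) = X' * Y' := by rw [hφψ, hXY]
    obtain ⟨ψ', hψ'co, hfac'⟩ := hF.iii_d_under_full φ' (φ ≫ ψ) hφ'co
      ⟨hco _, IsPreStep.comp F hφ.1 hψ.1⟩ (by rw [e, hφ'x]; exact Dvd.intro _ rfl)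
    have hY'e : pull Φ (Base F φ') (Div F ψ') = Y' := by
      have h : Div F (φ' ≫ ψ') = pull Φ (Base F φ') (Div F ψ') * Div F φ' :=
        div_comp_of_isLinear φ' hψ'co.2.1
      rw [hfac', e, hφ'x, mul_comm] at h
      exact (mul_right_cancel h).symm
    have hφ'step : IsStep F φ' :=
      ⟨hφ'co.2, fun _ => hX' (by rw [← hφ'x]; exact isIsometry_of_isIso F hP φ')⟩
    have hψ'step : IsStep F ψ' := ⟨hψ'co.2, fun _ => hY' (by
      rw [← hY'e, show Div F ψ' = 1 from isIsometry_of_isIso F hP ψ', map_one])⟩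
    obtain ⟨A'', φ'', ζ, ζ', hφ'', hζ, hζ', h1, h2⟩ := hC φ' ψ' hφ'step hψ'step hfac'
    refine ⟨Div F φ'', div_ne_one_of_isStep histr hφ'', ?_, ?_⟩
    · rw [← h1, div_comp_of_isLinear φ'' hζ.1]
      exact Dvd.intro_left _ rfl
    · rw [← hφ'x, ← h2, div_comp_of_isLinear φ'' hζ'.1]
      exact Dvd.intro_left _ rfl
  · intro hM A' φ' ψ' hφ' hψ' hfac'
    haveI : IsIso (Base F φ') := hφ'.1.2
    have hX' : Div F φ' ≠ 1 := div_ne_one_of_isStep histr hφ'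
    have hY' : pull Φ (Base F φ') (Div F ψ') ≠ 1 := fun h => div_ne_one_of_isStep histr hψ' (by
      have h' := congrArg (pull Φ (inv (Base F φ'))) h
      rwa [← pull_comp, IsIso.inv_hom_id, pull_id, map_one] at h')
    have hXY : Div F φ * pull Φ (Base F φ) (Div F ψ) = Div F φ' * pull Φ (Base F φ') (Div F ψ') := by
      rw [← hφψ, ← hfac', div_comp_of_isLinear φ' hψ'.1.1, mul_comm]
    obtain ⟨X'', hX''1, hX''φ, hX''φ'⟩ := hM _ _ hX' hY' hXY
    obtain ⟨A'', φ'', hφ''co, hφ''x⟩ := hF.iii_d_under_surj B X''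
    obtain ⟨ζ, hζco, h1⟩ := hF.iii_d_under_full φ'' φ hφ''co ⟨hco φ, hφ.1⟩
      (by rw [hφ''x]; exact hX''φ)
    obtain ⟨ζ', hζ'co, h2⟩ := hF.iii_d_under_full φ'' φ' hφ''co ⟨hco φ', hφ'.1⟩
      (by rw [hφ''x]; exact hX''φ')
    exact ⟨A'', φ'', ζ, ζ', ⟨hφ''co.2, fun _ => hX''1 (by
      rw [← hφ''x]; exact isIsometry_of_isIso F hP φ'')⟩, hζco.2, hζ'co.2, h1, h2⟩

end PreFrobenioid

end Literature.AlgebraicGeometry.Frobenioids
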